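import Mathlib.Analysis.SpecialFunctions.Sqrt
import Mathlib.Analysis.InnerProductSpace.Calculus
import Literature.Geometry.Symplectic.SphereAreaForm

/-!
# Helper `helper_archimedesMap` of line `stable-seam-host` for crux `OrigamiFoldExistence`
(item stmt-SmoothPoincare4-7844, route route-SmoothPoincare4-SymplecticOrigami; lead c10, wave 1)

First brick of the registered helper `helper_stableSeamHypotheses_inhabited` (NON-VACUITY of the
hypothesis package of STUB 3 v2 at `S = S⁴`: the seam of a genuine ball, embedded in the host
`(S² × S², σ ⊕ σ)` as a round contact sphere, is `Ω`-stable).  The witness embeds the Darboux ball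
`B⁴(2) ⊂ (ℝ⁴, ω₀)` symplectically into `S² × S²` as a product of two equal-area charts of the
round sphere; this file supplies the chart:

* `helper_archimedesMap` — **the Archimedes (Lambert equal-area) symplectic chart of `(S², σ)`**:
  a map `F : ℝ² → S²` which on the disc `‖z‖ < 2` is `F(z) = (z₀ s, z₁ s, 1 - ‖z‖²/2)`,
  `s = √(1 - ‖z‖²/4)` (height `h = 1 - r²/2`, so that `dh ∧ dθ = -r dr ∧ dθ`), is `C^∞`, injective
  and immersive there, and pulls the area form `σ_x(ξ, η) = det(x, ξ, η)` of
  `Literature.Geometry.Symplectic.sphereAreaForm` (McDuff–Salamon 2017, Ex. 3.1.2) back to the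
  standard area form: `σ_{F z}(dF a, dF b) = a₀ b₁ - a₁ b₀` EXACTLY (Archimedes: the horizontal
  projection of the sphere onto the circumscribed cylinder preserves area; in symplectic terms
  `σ = dθ ∧ dx₃` in cylindrical coordinates, McDuff–Salamon 2017, Ex. 3.1.2).

Everything is stated def-free: the ambient map `A`, its height factor `s` and the sphere-valued
`F` enter the private lemmas as variables constrained by their defining equations, and the
registered statement is an existence.  Proof: `A` is `C^∞` on the open disc (`√` is smooth on
`(0, ∞)`), its differential is `dA_z(h) = (h₀ s - z₀⟪z,h⟫/(4s), h₁ s - z₁⟪z,h⟫/(4s), -⟪z,h⟫)`, and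
`det(A z, dA_z a, dA_z b) = a₀ b₁ - a₁ b₀` is a polynomial identity modulo `s² = 1 - ‖z‖²/4`
(`linear_combination`); smoothness of the sphere-valued map is Mathlib's
`ContMDiff.codRestrict_sphere` on the open submanifold `‖z‖ < 2`, and immersivity follows from the
symplectic identity (`σ(dF a, dF(-a₁, a₀)) = ‖a‖²`).

Sources: D. McDuff, D. Salamon, *Introduction to Symplectic Topology*, 3rd ed. (2017), Ex. 3.1.2;
Archimedes, *On the Sphere and Cylinder* I (the hat-box theorem); folklore calculus.
-/

noncomputable section

-- the prescribed namespace `Summit.<P>.<Sub>.…` duplicates `SmoothPoincare4` (P = Sub)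
set_option linter.dupNamespace false

open scoped Manifold ContDiff Topology RealInnerProductSpace
open Set Function Metric
open Literature.Geometry.Symplectic Literature.Geometry.Kaehler

namespace Summit.SmoothPoincare4.SmoothPoincare4.Theorems.OrigamiFoldExistence.StableSeamHost

/-! ### Coordinates on `ℝ²` and `ℝ³` -/

/-- `‖z‖² = z₀² + z₁²` on `ℝ²`. [folklore] -/
private theorem norm_sq_two (z : EuclideanSpace ℝ (Fin 2)) : ‖z‖ ^ 2 = z 0 ^ 2 + z 1 ^ 2 := by
  rw [EuclideanSpace.real_norm_sq_eq, Fin.sum_univ_two]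

/-- `‖x‖² = Σ xᵢ²` on `ℝ³`. [folklore] -/
private theorem norm_sq_three (x : EuclideanSpace ℝ (Fin 3)) :
    ‖x‖ ^ 2 = x 0 ^ 2 + x 1 ^ 2 + x 2 ^ 2 := by
  rw [EuclideanSpace.real_norm_sq_eq, Fin.sum_univ_three]

/-- The real inner product on `ℝ²` in coordinates. [folklore] -/
private theorem inner_two (z h : EuclideanSpace ℝ (Fin 2)) : ⟪z, h⟫ = z 0 * h 0 + z 1 * h 1 := by
  simp [PiLp.inner_apply, Fin.sum_univ_two, mul_comm]

/-! ### The ambient Archimedes map `A(z) = (z₀ s, z₁ s, 1 - ‖z‖²/2)`, `s = √(1 - ‖z‖²/4)` -/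

section Ambient

variable {s : EuclideanSpace ℝ (Fin 2) → ℝ} {A : EuclideanSpace ℝ (Fin 2) → EuclideanSpace ℝ (Fin 3)}
  (hs : ∀ z, s z = Real.sqrt (1 - 4⁻¹ * ‖z‖ ^ 2))
  (hA : ∀ z, A z = (z 0 * s z) • (EuclideanSpace.single 0 1 : EuclideanSpace ℝ (Fin 3)) +
    (z 1 * s z) • (EuclideanSpace.single 1 1 : EuclideanSpace ℝ (Fin 3)) +
    (1 - 2⁻¹ * ‖z‖ ^ 2) • (EuclideanSpace.single 2 1 : EuclideanSpace ℝ (Fin 3)))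

include hs in
/-- In the disc of radius `2` the height factor squares to `1 - ‖z‖²/4`. [folklore] -/
private theorem s_sq {z : EuclideanSpace ℝ (Fin 2)} (hz : ‖z‖ < 2) :
    s z ^ 2 = 1 - 4⁻¹ * ‖z‖ ^ 2 := by
  rw [hs]
  apply Real.sq_sqrt
  nlinarith [norm_nonneg z]

include hs in
/-- In the disc of radius `2` the height factor is positive. [folklore] -/
private theorem s_pos {z : EuclideanSpace ℝ (Fin 2)} (hz : ‖z‖ < 2) : 0 < s z := by
  rw [hs]
  apply Real.sqrt_pos.2
  nlinarith [norm_nonneg z]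

include hA in
/-- The coordinates of the Archimedes map. [folklore] -/
private theorem archA_apply (z : EuclideanSpace ℝ (Fin 2)) :
    A z 0 = z 0 * s z ∧ A z 1 = z 1 * s z ∧ A z 2 = 1 - 2⁻¹ * ‖z‖ ^ 2 := by
  refine ⟨?_, ?_, ?_⟩ <;> simp [hA]

include hs hA in
/-- The Archimedes map takes the disc of radius `2` to the unit sphere. [folklore] -/
private theorem archA_mem {z : EuclideanSpace ℝ (Fin 2)} (hz : ‖z‖ < 2) :
    A z ∈ Metric.sphere (0 : EuclideanSpace ℝ (Fin 3)) 1 := by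
  obtain ⟨h0, h1, h2⟩ := archA_apply (s := s) hA z
  have hs2 := s_sq hs hz
  have ht := norm_sq_two z
  have h : ‖A z‖ ^ 2 = 1 := by
    rw [norm_sq_three, h0, h1, h2]
    nlinarith [hs2, ht]
  rw [mem_sphere_zero_iff_norm]
  nlinarith [norm_nonneg (A z)]

include hs hA in
/-- The Archimedes map is `C^∞` on the disc of radius `2`. [folklore] -/
private theorem contDiffAt_archA {z : EuclideanSpace ℝ (Fin 2)} (hz : ‖z‖ < 2) :
    ContDiffAt ℝ ∞ A z := by
  have hA' : A = fun z => (z 0 * s z) • (EuclideanSpace.single 0 1 : EuclideanSpace ℝ (Fin 3)) +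
      (z 1 * s z) • (EuclideanSpace.single 1 1 : EuclideanSpace ℝ (Fin 3)) +
      (1 - 2⁻¹ * ‖z‖ ^ 2) • (EuclideanSpace.single 2 1 : EuclideanSpace ℝ (Fin 3)) := funext hA
  have hs' : s = fun z : EuclideanSpace ℝ (Fin 2) => Real.sqrt (1 - 4⁻¹ * ‖z‖ ^ 2) := funext hs
  have hn : ContDiff ℝ ∞ (fun z : EuclideanSpace ℝ (Fin 2) => ‖z‖ ^ 2) := contDiff_norm_sq ℝ
  have hsz : ContDiffAt ℝ ∞ s z := by
    rw [hs']
    refine ContDiffAt.sqrt ?_ ?_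
    · exact (contDiff_const.sub (contDiff_const.mul hn)).contDiffAt
    · nlinarith [norm_nonneg z]
  have h0 : ContDiff ℝ ∞ (fun z : EuclideanSpace ℝ (Fin 2) => z 0) :=
    (EuclideanSpace.proj (𝕜 := ℝ) (0 : Fin 2)).contDiff
  have h1 : ContDiff ℝ ∞ (fun z : EuclideanSpace ℝ (Fin 2) => z 1) :=
    (EuclideanSpace.proj (𝕜 := ℝ) (1 : Fin 2)).contDiff
  rw [hA']
  exact (((h0.contDiffAt.mul hsz).smul contDiffAt_const).add
    ((h1.contDiffAt.mul hsz).smul contDiffAt_const)).add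
    ((contDiff_const.sub (contDiff_const.mul hn)).contDiffAt.smul contDiffAt_const)

include hs hA in
/-- The differential of the Archimedes map in coordinates:
`dA_z(h) = (h₀ s - z₀⟪z,h⟫/(4s), h₁ s - z₁⟪z,h⟫/(4s), -⟪z,h⟫)`. [folklore] -/
private theorem hasFDerivAt_archA {z : EuclideanSpace ℝ (Fin 2)} (hz : ‖z‖ < 2) :
    ∃ L : EuclideanSpace ℝ (Fin 2) →L[ℝ] EuclideanSpace ℝ (Fin 3), HasFDerivAt A L z ∧
      ∀ h : EuclideanSpace ℝ (Fin 2),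
        L h 0 = h 0 * s z - z 0 * (z 0 * h 0 + z 1 * h 1) * (s z)⁻¹ / 4 ∧
        L h 1 = h 1 * s z - z 1 * (z 0 * h 0 + z 1 * h 1) * (s z)⁻¹ / 4 ∧
        L h 2 = -(z 0 * h 0 + z 1 * h 1) := by
  have hs' : s = fun z : EuclideanSpace ℝ (Fin 2) => Real.sqrt (1 - 4⁻¹ * ‖z‖ ^ 2) := funext hs
  have hne : 1 - 4⁻¹ * ‖z‖ ^ 2 ≠ 0 := by nlinarith [norm_nonneg z]
  have hn : HasFDerivAt (fun z : EuclideanSpace ℝ (Fin 2) => ‖z‖ ^ 2) ((2 : ℕ) • innerSL ℝ z) z :=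
    (hasStrictFDerivAt_norm_sq z).hasFDerivAt
  have hf : HasFDerivAt (fun z : EuclideanSpace ℝ (Fin 2) => 1 - 4⁻¹ * ‖z‖ ^ 2)
      (-((4 : ℝ)⁻¹ • ((2 : ℕ) • innerSL ℝ z))) z :=
    (hn.const_mul 4⁻¹).const_sub 1
  have hsd : HasFDerivAt s ((1 / (2 * Real.sqrt (1 - 4⁻¹ * ‖z‖ ^ 2))) •
      -((4 : ℝ)⁻¹ • ((2 : ℕ) • innerSL ℝ z))) z := by
    rw [hs']
    exact hf.sqrt hne
  have h0 : HasFDerivAt (fun z : EuclideanSpace ℝ (Fin 2) => z 0)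
      (EuclideanSpace.proj (𝕜 := ℝ) (0 : Fin 2)) z :=
    (EuclideanSpace.proj (𝕜 := ℝ) (0 : Fin 2)).hasFDerivAt
  have h1 : HasFDerivAt (fun z : EuclideanSpace ℝ (Fin 2) => z 1)
      (EuclideanSpace.proj (𝕜 := ℝ) (1 : Fin 2)) z :=
    (EuclideanSpace.proj (𝕜 := ℝ) (1 : Fin 2)).hasFDerivAt
  have h2 : HasFDerivAt (fun z : EuclideanSpace ℝ (Fin 2) => 1 - 2⁻¹ * ‖z‖ ^ 2)
      (-((2 : ℝ)⁻¹ • ((2 : ℕ) • innerSL ℝ z))) z :=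
    (hn.const_mul 2⁻¹).const_sub 1
  have hall := (((h0.mul hsd).smul_const
    (EuclideanSpace.single 0 1 : EuclideanSpace ℝ (Fin 3))).add
    ((h1.mul hsd).smul_const (EuclideanSpace.single 1 1 : EuclideanSpace ℝ (Fin 3)))).add
    (h2.smul_const (EuclideanSpace.single 2 1 : EuclideanSpace ℝ (Fin 3)))
  refine ⟨_, hall.congr_of_eventuallyEq (Filter.Eventually.of_forall fun y => by simp [hA]),
    fun h => ?_⟩
  have hsq : Real.sqrt (1 - 4⁻¹ * ‖z‖ ^ 2) = s z := (hs z).symm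
  refine ⟨?_, ?_, ?_⟩ <;> simp [hsq, inner_two] <;> ring

include hs hA in
/-- **Archimedes' equal-area theorem, infinitesimally**: `det(A(z), dA_z a, dA_z b) = a₀ b₁ - a₁ b₀`
on the disc of radius `2`, i.e. `A^*(ι_x dvol) = dx ∧ dy` — the Archimedes–Lambert cylindrical
projection is area preserving (McDuff–Salamon 2017, Ex. 3.1.2: `σ = dθ ∧ dx₃` in cylindrical
coordinates). [folklore] -/
private theorem ambientAreaAlt_archA {z : EuclideanSpace ℝ (Fin 2)} (hz : ‖z‖ < 2)
    (a b : EuclideanSpace ℝ (Fin 2)) :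
    ambientAreaAlt (A z) ![fderiv ℝ A z a, fderiv ℝ A z b] = a 0 * b 1 - a 1 * b 0 := by
  obtain ⟨L, hL, hLc⟩ := hasFDerivAt_archA hs hA hz
  obtain ⟨ha0, ha1, ha2⟩ := hLc a
  obtain ⟨hb0, hb1, hb2⟩ := hLc b
  obtain ⟨h0, h1, h2⟩ := archA_apply (s := s) hA z
  rw [hL.fderiv, ambientAreaAlt_apply, ha0, ha1, ha2, hb0, hb1, hb2, h0, h1, h2, norm_sq_two]
  have hs2 : s z ^ 2 = 1 - 4⁻¹ * (z 0 ^ 2 + z 1 ^ 2) := by rw [← norm_sq_two]; exact s_sq hs hz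
  have hsi : s z * (s z)⁻¹ = 1 := mul_inv_cancel₀ (s_pos hs hz).ne'
  linear_combination (a 0 * b 1 - a 1 * b 0) * (1 + (z 0 ^ 2 + z 1 ^ 2) / 2) * hs2 -
    (a 0 * b 1 - a 1 * b 0) * (1 - (z 0 ^ 2 + z 1 ^ 2) / 2) * ((z 0 ^ 2 + z 1 ^ 2) / 4) * hsi

/-! ### The sphere-valued Archimedes map -/

variable {F : EuclideanSpace ℝ (Fin 2) → Metric.sphere (0 : EuclideanSpace ℝ (Fin 3)) 1}
  (hF : ∀ z, ‖z‖ < 2 → (F z : EuclideanSpace ℝ (Fin 3)) = A z)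

include hs hA hF in
/-- A sphere-valued map agreeing with `A` on the disc of radius `2` is `C^∞` there (Mathlib's
`ContMDiff.codRestrict_sphere` on the open submanifold `‖z‖ < 2`). [folklore] -/
private theorem contMDiffOn_archF : ContMDiffOn (𝓡 2) (𝓡 2) ∞ F (ball 0 2) := by
  haveI : Fact (Module.finrank ℝ (EuclideanSpace ℝ (Fin 3)) = 2 + 1) :=
    ⟨finrank_euclideanSpace_fin⟩
  let D : TopologicalSpace.Opens (EuclideanSpace ℝ (Fin 2)) := ⟨ball 0 2, isOpen_ball⟩
  have hmem : ∀ x : D, A x.1 ∈ Metric.sphere (0 : EuclideanSpace ℝ (Fin 3)) 1 := fun x =>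
    archA_mem hs hA (mem_ball_zero_iff.1 x.2)
  have hAD : ContMDiff (𝓡 2) 𝓘(ℝ, EuclideanSpace ℝ (Fin 3)) ∞ (fun x : D => A x.1) := by
    have h1 : ContMDiffOn (𝓡 2) 𝓘(ℝ, EuclideanSpace ℝ (Fin 3)) ∞ A (ball 0 2) := by
      rw [contMDiffOn_iff_contDiffOn]
      exact fun z hz => (contDiffAt_archA hs hA (mem_ball_zero_iff.1 hz)).contDiffWithinAt
    exact h1.comp_contMDiff contMDiff_subtype_val (fun x => x.2)
  have hFD : ContMDiff (𝓡 2) (𝓡 2) ∞ (fun x : D => F x.1) := by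
    have h := hAD.codRestrict_sphere (n := 2) hmem
    have hfun : (fun x : D => F x.1) = Set.codRestrict (fun x : D => A x.1) _ hmem := by
      funext x
      exact Subtype.ext (hF x.1 (mem_ball_zero_iff.1 x.2))
    rw [hfun]
    exact h
  intro z hz
  exact (contMDiffAt_subtype_iff.1 (hFD ⟨z, hz⟩)).contMDiffWithinAt

include hs hA hF in
/-- The ambient image of the differential of `F`: `dι (dF_z a) = dA_z a` (chain rule for
`ι ∘ F = A` near `z`, `ι : S² ↪ ℝ³`). [folklore] -/
private theorem mfderiv_val_archF {z : EuclideanSpace ℝ (Fin 2)} (hz : ‖z‖ < 2)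
    (a : EuclideanSpace ℝ (Fin 2)) :
    mfderiv (𝓡 2) 𝓘(ℝ, EuclideanSpace ℝ (Fin 3))
      (Subtype.val : Metric.sphere (0 : EuclideanSpace ℝ (Fin 3)) 1 → EuclideanSpace ℝ (Fin 3))
      (F z) (mfderiv (𝓡 2) (𝓡 2) F z a) = fderiv ℝ A z a := by
  haveI : Fact (Module.finrank ℝ (EuclideanSpace ℝ (Fin 3)) = 2 + 1) :=
    ⟨finrank_euclideanSpace_fin⟩
  have hzb : z ∈ ball (0 : EuclideanSpace ℝ (Fin 2)) 2 := mem_ball_zero_iff.2 hz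
  have hFd : MDifferentiableAt (𝓡 2) (𝓡 2) F z :=
    ((contMDiffOn_archF hs hA hF).contMDiffAt (isOpen_ball.mem_nhds hzb)).mdifferentiableAt
      (by simp)
  have hval : MDifferentiableAt (𝓡 2) 𝓘(ℝ, EuclideanSpace ℝ (Fin 3))
      (Subtype.val : Metric.sphere (0 : EuclideanSpace ℝ (Fin 3)) 1 → EuclideanSpace ℝ (Fin 3))
      (F z) :=
    (contMDiff_coe_sphere (E := EuclideanSpace ℝ (Fin 3)) (n := 2) (m := ∞)
      (F z)).mdifferentiableAt (by simp)
  have hcomp := mfderiv_comp z hval hFd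
  have heq : (Subtype.val ∘ F) =ᶠ[𝓝 z] A := by
    filter_upwards [isOpen_ball.mem_nhds hzb] with y hy
    exact hF y (mem_ball_zero_iff.1 hy)
  rw [← ContinuousLinearMap.comp_apply, ← hcomp, heq.mfderiv_eq, mfderiv_eq_fderiv]
  rfl

include hs hA hF in
/-- **`F^*σ = dx ∧ dy` on the disc of radius `2`**: the Archimedes map is a symplectic chart of
`(S², σ)`. [folklore] -/
private theorem sphereAreaForm_archF {z : EuclideanSpace ℝ (Fin 2)} (hz : ‖z‖ < 2)
    (a b : EuclideanSpace ℝ (Fin 2)) :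
    sphereAreaForm (F z) ![mfderiv (𝓡 2) (𝓡 2) F z a, mfderiv (𝓡 2) (𝓡 2) F z b] =
      a 0 * b 1 - a 1 * b 0 := by
  rw [sphereAreaForm_apply, mfderiv_val_archF hs hA hF hz, mfderiv_val_archF hs hA hF hz, hF z hz]
  exact ambientAreaAlt_archA hs hA hz a b

include hs hA hF in
/-- The differential of `F` is injective on the disc (a symplectic map is an immersion:
`σ(dF a, dF (-a₁, a₀)) = ‖a‖²`). [folklore] -/
private theorem injective_mfderiv_archF {z : EuclideanSpace ℝ (Fin 2)} (hz : ‖z‖ < 2) :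
    Injective (mfderiv (𝓡 2) (𝓡 2) F z) := by
  refine (injective_iff_map_eq_zero _).2 fun (c : EuclideanSpace ℝ (Fin 2)) hc => ?_
  have key := sphereAreaForm_archF hs hA hF hz c
    ((-c 1) • (EuclideanSpace.single 0 1 : EuclideanSpace ℝ (Fin 2)) +
      (c 0) • (EuclideanSpace.single 1 1 : EuclideanSpace ℝ (Fin 2)))
  have h0 : sphereAreaForm (F z) ![mfderiv (𝓡 2) (𝓡 2) F z c, mfderiv (𝓡 2) (𝓡 2) F z
      ((-c 1) • (EuclideanSpace.single 0 1 : EuclideanSpace ℝ (Fin 2)) +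
        (c 0) • (EuclideanSpace.single 1 1 : EuclideanSpace ℝ (Fin 2)))] = 0 :=
    (sphereAreaForm (F z)).map_coord_zero 0 (by simp [hc])
  rw [h0] at key
  simp at key
  have hc0 : c 0 = 0 := by nlinarith
  have hc1 : c 1 = 0 := by nlinarith
  refine PiLp.ext fun i => ?_
  fin_cases i
  · exact hc0
  · exact hc1

include hs hA hF in
/-- The Archimedes map is injective on the disc of radius `2`. [folklore] -/
private theorem injOn_archF : InjOn F (ball 0 2) := by
  intro z hz z' hz' h
  have hz2 := mem_ball_zero_iff.1 hz
  have hz2' := mem_ball_zero_iff.1 hz'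
  have hAz : A z = A z' := by rw [← hF z hz2, ← hF z' hz2', h]
  obtain ⟨h0, h1, h2⟩ := archA_apply (s := s) hA z
  obtain ⟨h0', h1', h2'⟩ := archA_apply (s := s) hA z'
  rw [hAz] at h0 h1 h2
  have hn : ‖z‖ ^ 2 = ‖z'‖ ^ 2 := by rw [h2'] at h2; linarith
  have hss : s z = s z' := by rw [hs, hs, hn]
  have hs0 : s z' ≠ 0 := (s_pos hs hz2').ne'
  have e0 : z 0 = z' 0 := by
    rw [h0', hss] at h0
    exact (mul_right_cancel₀ hs0 h0).symm
  have e1 : z 1 = z' 1 := by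
    rw [h1', hss] at h1
    exact (mul_right_cancel₀ hs0 h1).symm
  ext i
  fin_cases i
  · exact e0
  · exact e1

end Ambient

/-! ### The registered helper -/

/-- **The Archimedes symplectic chart of the round 2-sphere** (McDuff–Salamon 2017, Ex. 3.1.2 /
cylindrical coordinates `σ = dθ ∧ dx₃`; Archimedes–Lambert equal-area projection): there is a map
`F : ℝ² → S²`, `F(z) = (z₀ s, z₁ s, 1 - ‖z‖²/2)`, `s = √(1 - ‖z‖²/4)` on the disc `‖z‖ < 2`, which is
`C^∞`, injective and immersive there and pulls the area form `σ` back to `dx ∧ dy`: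
`σ_{F z}(dF a, dF b) = a₀ b₁ - a₁ b₀`. [folklore] -/
theorem helper_archimedesMap :
    ∃ F : EuclideanSpace ℝ (Fin 2) → (Metric.sphere (0 : EuclideanSpace ℝ (Fin 3)) 1), ContMDiffOn (𝓡 2) (𝓡 2) ∞ F (Metric.ball 0 2) ∧ Set.InjOn F (Metric.ball 0 2) ∧ (∀ z ∈ Metric.ball (0 : EuclideanSpace ℝ (Fin 2)) 2, Function.Injective (mfderiv (𝓡 2) (𝓡 2) F z)) ∧ ∀ z ∈ Metric.ball (0 : EuclideanSpace ℝ (Fin 2)) 2, ∀ a b : EuclideanSpace ℝ (Fin 2), Literature.Geometry.Symplectic.sphereAreaForm (F z) ![mfderiv (𝓡 2) (𝓡 2) F z a, mfderiv (𝓡 2) (𝓡 2) F z b] = a 0 * b 1 - a 1 * b 0 := by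
  classical
  obtain ⟨s, hs⟩ : ∃ s : EuclideanSpace ℝ (Fin 2) → ℝ, ∀ z, s z = Real.sqrt (1 - 4⁻¹ * ‖z‖ ^ 2) :=
    ⟨_, fun z => rfl⟩
  obtain ⟨A, hA⟩ : ∃ A : EuclideanSpace ℝ (Fin 2) → EuclideanSpace ℝ (Fin 3), ∀ z,
      A z = (z 0 * s z) • (EuclideanSpace.single 0 1 : EuclideanSpace ℝ (Fin 3)) +
        (z 1 * s z) • (EuclideanSpace.single 1 1 : EuclideanSpace ℝ (Fin 3)) +
        (1 - 2⁻¹ * ‖z‖ ^ 2) • (EuclideanSpace.single 2 1 : EuclideanSpace ℝ (Fin 3)) :=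
    ⟨_, fun z => rfl⟩
  let F : EuclideanSpace ℝ (Fin 2) → Metric.sphere (0 : EuclideanSpace ℝ (Fin 3)) 1 := fun z =>
    if h : ‖z‖ < 2 then ⟨A z, archA_mem hs hA h⟩ else ⟨EuclideanSpace.single 2 1, by simp⟩
  have hF : ∀ z, ‖z‖ < 2 → (F z : EuclideanSpace ℝ (Fin 3)) = A z := fun z hz => by
    simp [F, dif_pos hz]
  exact ⟨F, contMDiffOn_archF hs hA hF, injOn_archF hs hA hF,
    fun z hz => injective_mfderiv_archF hs hA hF (mem_ball_zero_iff.1 hz),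
    fun z hz a b => sphereAreaForm_archF hs hA hF (mem_ball_zero_iff.1 hz) a b⟩

end Summit.SmoothPoincare4.SmoothPoincare4.Theorems.OrigamiFoldExistence.StableSeamHost

end
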